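import Summits.Ventures.PercRepro.S1CoreCapDisjoint

/-!
# PercRepro — cap(5) = 5: a 6-point plane of the e-free core carries at most 5 four-circuits through any of its
points (p1, gen 21; `proofs/P1-S4-PERPOINT.md` §9 (2))

Kill counting on the 10 three-subsets of `Q := P ∖ {e}`: the rank-2 triple `{e, a, b}` through `e` kills the 3
subsets through `{a, b}`; the triple at a third point `c` is `{e, c, z}` (3 more kills, ≥ 6 in all) or a triple
`{c, x, y} ⊆ Q`; two DISJOINT lines `{e, a, b}`, `{c, x, y}` are impossible (`S1CoreCapDisjoint`: `hfree` at `a` —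
the two sides of `a` inside `P` would be `{c, x, y}` and `{e, b}`, but `a ∈ cl {e, b}`), so `{c, x, y}` meets `{a, b}`
in one point and is a 4th kill; the triple at the fifth point `w` of `Q` gives a 5th (through `e`: 3 kills through `{w, v}`, at most
one of them old; inside `Q`: a new 3-subset). Hence `#𝒞 ≤ 10 − 5`.
* **`ncard_fourCircuitsThrough_in_six_plane_le_five`**.
Axioms: standard.
-/

open scoped Matroid

namespace PercRepro

namespace S1

open Set

variable {α : Type}

/-- A rank-`≤ 2` triple of the core through `e` and a point `u` of a rank-`≤ 2` triple `{e, a, b}`: `u ∈ {a, b}`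
forces the triples to coincide (they share `e, u`), so a second such triple `{e, u, v}` has `u, v ∉ {a, b}`
unless it is the same triple. -/
theorem ne_of_rank_two_triples_through (M : Matroid α) [M.Finite]
    (hfree : ∀ e ∈ M.E, ∃ A ⊆ M.E \ {e}, e ∉ M.closure A ∧ e ∉ M.closure ((M.E \ {e}) \ A))
    {e a b u v : α} (hE : ({e, a, b, u, v} : Set α) ⊆ M.E)
    (hab : M.eRk {e, a, b} ≤ 2) (huv : M.eRk {e, u, v} ≤ 2)
    (hae : a ≠ e) (hbe : b ≠ e) (hab' : a ≠ b) (hue : u ≠ e) (hve : v ≠ e) (huv' : u ≠ v)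
    (hne : ({e, a, b} : Set α) ≠ {e, u, v}) : u ≠ a ∧ u ≠ b ∧ v ≠ a ∧ v ≠ b := by
  have hT1 : ({e, a, b} : Set α) ⊆ M.E := fun t ht => hE (by
    simp only [mem_insert_iff, mem_singleton_iff] at ht ⊢; tauto)
  have hT2 : ({e, u, v} : Set α) ⊆ M.E := fun t ht => hE (by
    simp only [mem_insert_iff, mem_singleton_iff] at ht ⊢; tauto)
  have h3a : ({e, a, b} : Set α).ncard = 3 := ncard_eq_three.2 ⟨e, a, b, hae.symm, hbe.symm, hab', rfl⟩
  have h3u : ({e, u, v} : Set α).ncard = 3 := ncard_eq_three.2 ⟨e, u, v, hue.symm, hve.symm, huv', rfl⟩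
  have hint := inter_ncard_le_one_of_triples M hfree hT1 hT2 hab huv h3a h3u hne
  have key : ∀ w, w ≠ e → w ∈ ({e, a, b} : Set α) → w ∈ ({e, u, v} : Set α) → False := by
    intro w hwe hw1 hw2
    have : ({e, w} : Set α) ⊆ {e, a, b} ∩ {e, u, v} := by
      intro t ht; simp only [mem_insert_iff, mem_singleton_iff] at ht
      rcases ht with rfl | rfl
      · exact ⟨by simp, by simp⟩
      · exact ⟨hw1, hw2⟩
    have := ncard_le_ncard this ((toFinite _).inter_of_left _)
    rw [ncard_pair hwe.symm] at this; omega
  refine ⟨fun h => key u hue (by simp [h]) (by simp), fun h => key u hue (by simp [h]) (by simp),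
    fun h => key v hve (by simp [h]) (by simp), fun h => key v hve (by simp [h]) (by simp)⟩

/-- **cap(5) = 5**: a 6-point plane `P ∋ e` of the e-free core carries at most 5 four-circuits through `e`. -/
theorem ncard_fourCircuitsThrough_in_six_plane_le_five (M : Matroid α) [M.Finite]
    (hfree : ∀ e ∈ M.E, ∃ A ⊆ M.E \ {e}, e ∉ M.closure A ∧ e ∉ M.closure ((M.E \ {e}) \ A))
    {P : Set α} (hP : P ⊆ M.E) (hrP : M.eRk P ≤ 3) (h6 : P.ncard = 6) {e : α} (he : e ∈ P) :
    {C : Set α | M.IsCircuit C ∧ C.ncard = 4 ∧ e ∈ C ∧ C ⊆ P}.ncard ≤ 5 := by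
  classical
  have hPfin : P.Finite := M.ground_finite.subset hP
  set Q := P \ {e} with hQ
  have hQfin : Q.Finite := hPfin.subset sdiff_subset
  have hQ5 : Q.ncard = 5 := by
    have := ncard_sdiff_singleton_add_one he hPfin
    rw [← hQ] at this; omega
  have hQP : Q ⊆ P := sdiff_subset
  have hLS2 : ∀ X ⊆ M.E, M.eRk X ≤ 2 → X.ncard ≤ 3 := by
    intro X hX h
    have := ThmN.ncard_add_one_le_two_pow_of_eRk_le M (ThmN.not_isLoop_of_free M hfree) hfree 2 X hX h
    omega
  -- the kill machinery: it suffices to find `K ⊆ 𝒯` of `ncard ≥ 5` with no circuit mapping into it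
  suffices H : ∃ K : Set (Set α), K ⊆ {S : Set α | S ⊆ Q ∧ S.ncard = 3} ∧ 5 ≤ K.ncard ∧
      ∀ C, M.IsCircuit C → C.ncard = 4 → e ∈ C → C ⊆ P → C \ {e} ∉ K by
    obtain ⟨K, hK, hK5, hkill⟩ := H
    have := ncard_fourCircuitsThrough_in_plane_le_of_kill M hP hK hkill
    rw [← hQ, hQ5] at this
    have h10 : Nat.choose 5 3 = 10 := by decide
    rw [h10] at this
    omega
  -- the rank-2 triple through `e`: `{e, a, b}`
  obtain ⟨a, haP, b, hbP, hab, hae, hbe, hrab⟩ := exists_triple_through_of_ncard_six M hfree hP hrP h6 he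
  have haQ : a ∈ Q := ⟨haP, hae⟩
  have hbQ : b ∈ Q := ⟨hbP, hbe⟩
  set Kab := {S : Set α | S ⊆ Q ∧ S.ncard = 3 ∧ a ∈ S ∧ b ∈ S} with hKab
  have hKab3 : Kab.ncard = 3 := by
    rw [hKab, ncard_triples_through_pair Q hQfin haQ hbQ hab, hQ5]
  have hKabsub : Kab ⊆ {S : Set α | S ⊆ Q ∧ S.ncard = 3} := fun S hS => ⟨hS.1, hS.2.1⟩
  have hKabkill := not_mem_kill_of_line M (P := P) hrab hae hbe hab
  -- a third point `c`
  have hQab : 1 ≤ (Q \ {a, b}).ncard := by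
    have hsub : ({a, b} : Set α) ⊆ Q := by
      intro t ht; simp only [mem_insert_iff, mem_singleton_iff] at ht; rcases ht with rfl | rfl; exact haQ; exact hbQ
    have := ncard_sdiff_add_ncard_of_subset hsub hQfin
    rw [ncard_pair hab] at this; omega
  obtain ⟨c, hcQ, hcab⟩ := nonempty_of_ncard_ne_zero (by omega : (Q \ {a, b}).ncard ≠ 0)
  have hca : c ≠ a := fun h => hcab (by rw [h]; simp)
  have hcb : c ≠ b := fun h => hcab (by rw [h]; simp)
  have hce : c ≠ e := hcQ.2
  obtain ⟨x, hxP, y, hyP, hxy, hxc, hyc, hrcxy⟩ := exists_triple_through_of_ncard_six M hfree hP hrP h6 hcQ.1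
  -- the generic "second triple through e" kill: `{e, u, v}` rank 2 with `u, v ∈ Q` distinct, `{u, v} ≠ {a, b}`
  -- gives at least 2 new kills beyond `Kab`
  have hsecond : ∀ u v : α, u ∈ Q → v ∈ Q → u ≠ v → M.eRk {e, u, v} ≤ 2 → ({e, a, b} : Set α) ≠ {e, u, v} →
      ∃ K : Set (Set α), K ⊆ {S : Set α | S ⊆ Q ∧ S.ncard = 3} ∧ 5 ≤ K.ncard ∧
        ∀ C, M.IsCircuit C → C.ncard = 4 → e ∈ C → C ⊆ P → C \ {e} ∉ K := by
    intro u v huQ hvQ huv hruv hne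
    have hE : ({e, a, b, u, v} : Set α) ⊆ M.E := by
      intro t ht; simp only [mem_insert_iff, mem_singleton_iff] at ht
      rcases ht with rfl | rfl | rfl | rfl | rfl
      · exact hP he
      · exact hP haP
      · exact hP hbP
      · exact hP huQ.1
      · exact hP hvQ.1
    obtain ⟨hua, hub, hva, hvb⟩ :=
      ne_of_rank_two_triples_through M hfree hE hrab hruv hae hbe hab huQ.2 hvQ.2 huv hne
    set Kuv := {S : Set α | S ⊆ Q ∧ S.ncard = 3 ∧ u ∈ S ∧ v ∈ S} with hKuv
    have hKuv3 : Kuv.ncard = 3 := by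
      rw [hKuv, ncard_triples_through_pair Q hQfin huQ hvQ huv, hQ5]
    have hdisj : Disjoint Kab Kuv := by
      rw [disjoint_left]
      intro S h1 h2
      have hsub : ({a, b, u, v} : Set α) ⊆ S := by
        intro t ht; simp only [mem_insert_iff, mem_singleton_iff] at ht
        rcases ht with rfl | rfl | rfl | rfl
        · exact h1.2.2.1
        · exact h1.2.2.2
        · exact h2.2.2.1
        · exact h2.2.2.2
      have h4 : ({a, b, u, v} : Set α).ncard = 4 := by
        rw [ncard_insert_of_notMem (by simp [hab, hua.symm, hva.symm]) (toFinite _),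
          ncard_eq_three.2 ⟨b, u, v, hub.symm, hvb.symm, huv, rfl⟩]
      have := ncard_le_ncard hsub (hQfin.subset h1.1)
      have hS3 := h1.2.1
      omega
    refine ⟨Kab ∪ Kuv, union_subset hKabsub (fun S hS => ⟨hS.1, hS.2.1⟩), ?_, ?_⟩
    · rw [ncard_union_eq hdisj (hQfin.finite_subsets.subset (fun S hS => hS.1))
        (hQfin.finite_subsets.subset (fun S hS => hS.1)), hKab3, hKuv3]
      norm_num
    · intro C hC hC4 heC hCP hmem
      rcases hmem with h | h
      · exact hKabkill C hC hC4 heC hCP h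
      · exact not_mem_kill_of_line M (P := P) hruv huQ.2 hvQ.2 huv C hC hC4 heC hCP h
  by_cases hex : e = x ∨ e = y
  · -- Case 1: the triple at `c` passes through `e`: `{e, c, z}`
    obtain ⟨z, hzP, hzc, hze, hrcz⟩ : ∃ z ∈ P, z ≠ c ∧ z ≠ e ∧ M.eRk {e, c, z} ≤ 2 := by
      rcases hex with h | h
      · refine ⟨y, hyP, hyc, fun h' => hxy (h'.trans h).symm, ?_⟩
        have : ({e, c, y} : Set α) = {c, x, y} := by rw [h, Set.insert_comm]
        rw [this]; exact hrcxy
      · refine ⟨x, hxP, hxc, fun h' => hxy (h'.trans h), ?_⟩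
        have : ({e, c, x} : Set α) = {c, x, y} := by rw [h, Set.insert_comm, Set.pair_comm]
        rw [this]; exact hrcxy
    exact hsecond c z hcQ ⟨hzP, hze⟩ hzc.symm hrcz (by
      intro h
      have : c ∈ ({e, a, b} : Set α) := h ▸ (by simp)
      simp only [mem_insert_iff, mem_singleton_iff] at this
      rcases this with h' | h' | h'
      · exact hce h'
      · exact hca h'
      · exact hcb h')
  · -- Case 2: the triple at `c` lies inside `Q`
    push Not at hex
    have hxe : x ≠ e := fun h => hex.1 h.symm
    have hye : y ≠ e := fun h => hex.2 h.symm
    have hxQ : x ∈ Q := ⟨hxP, hxe⟩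
    have hyQ : y ∈ Q := ⟨hyP, hye⟩
    have hT3 : ({c, x, y} : Set α).ncard = 3 := ncard_eq_three.2 ⟨c, x, y, hxc.symm, hyc.symm, hxy, rfl⟩
    have hTQ : ({c, x, y} : Set α) ⊆ Q := by
      intro t ht; simp only [mem_insert_iff, mem_singleton_iff] at ht
      rcases ht with rfl | rfl | rfl; exact hcQ; exact hxQ; exact hyQ
    have hTE : ({c, x, y} : Set α) ⊆ M.E := hTQ.trans (hQP.trans hP)
    have hEab : ({e, a, b} : Set α) ⊆ M.E := by
      intro t ht; simp only [mem_insert_iff, mem_singleton_iff] at ht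
      rcases ht with rfl | rfl | rfl; exact hP he; exact hP haP; exact hP hbP
    have h3ab : ({e, a, b} : Set α).ncard = 3 := ncard_eq_three.2 ⟨e, a, b, hae.symm, hbe.symm, hab, rfl⟩
    -- two distinct rank-2 triples share ≤ 1 point; `{c, x, y} ≠ {e, a, b}` (`e ∉ Q`)
    have hneT : ({e, a, b} : Set α) ≠ {c, x, y} := by
      intro h
      have : e ∈ ({c, x, y} : Set α) := h ▸ (by simp)
      exact (hTQ this).2 rfl
    have hshare := inter_ncard_le_one_of_triples M hfree hEab hTE hrab hrcxy h3ab hT3 hneT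
    -- `{x, y}` meets `{a, b}` in at most one point (both would put `a, b ∈ {c, x, y}`)
    have hnotboth : ¬ (a ∈ ({c, x, y} : Set α) ∧ b ∈ ({c, x, y} : Set α)) := by
      rintro ⟨ha', hb'⟩
      have : ({a, b} : Set α) ⊆ {e, a, b} ∩ {c, x, y} := by
        intro t ht; simp only [mem_insert_iff, mem_singleton_iff] at ht
        rcases ht with rfl | rfl
        · exact ⟨by simp, ha'⟩
        · exact ⟨by simp, hb'⟩
      have := ncard_le_ncard this ((toFinite _).inter_of_left _)
      rw [ncard_pair hab] at this; omega
    by_cases hmeet : a ∈ ({c, x, y} : Set α) ∨ b ∈ ({c, x, y} : Set α)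
    · -- Sub-case 2b: `{c, x, y} = {c, p, q}` with `p ∈ {a, b}`, `q ∉ {a, b, c}`
      obtain ⟨p, p', q, hp_ab, hp'_ab, hpp', hqQ, hqa, hqb, hqc, hTeq⟩ :
          ∃ p p' q : α, (p = a ∨ p = b) ∧ (p' = a ∨ p' = b) ∧ p ≠ p' ∧ q ∈ Q ∧ q ≠ a ∧ q ≠ b ∧ q ≠ c ∧
            ({c, x, y} : Set α) = {c, p, q} := by
        -- the point of `{x, y}` in `{a, b}` is `p`, the other point of `{x, y}` is `q`
        have hx_or_y : ∀ u, u ∈ ({c, x, y} : Set α) → u ≠ c → u = x ∨ u = y := by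
          intro u hu huc; simp only [mem_insert_iff, mem_singleton_iff] at hu
          rcases hu with h | h | h
          · exact absurd h huc
          · exact Or.inl h
          · exact Or.inr h
        rcases hmeet with ha' | hb'
        · rcases hx_or_y a ha' hca.symm with h | h
          · -- `a = x`, `q := y`
            refine ⟨a, b, y, Or.inl rfl, Or.inr rfl, hab, hyQ, fun h' => hxy (h.symm.trans h'.symm), ?_, hyc, ?_⟩
            · intro h'; exact hnotboth ⟨ha', by rw [← h']; simp⟩
            · rw [h]
          · -- `a = y`, `q := x`
            refine ⟨a, b, x, Or.inl rfl, Or.inr rfl, hab, hxQ, fun h' => hxy (h'.trans h), ?_, hxc, ?_⟩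
            · intro h'; exact hnotboth ⟨ha', by rw [← h']; simp⟩
            · rw [h, Set.pair_comm]
        · rcases hx_or_y b hb' hcb.symm with h | h
          · -- `b = x`, `q := y`
            refine ⟨b, a, y, Or.inr rfl, Or.inl rfl, hab.symm, hyQ, ?_, fun h' => hxy (h.symm.trans h'.symm), hyc, ?_⟩
            · intro h'; exact hnotboth ⟨by rw [← h']; simp, hb'⟩
            · rw [h]
          · -- `b = y`, `q := x`
            refine ⟨b, a, x, Or.inr rfl, Or.inl rfl, hab.symm, hxQ, ?_, fun h' => hxy (h'.trans h), hxc, ?_⟩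
            · intro h'; exact hnotboth ⟨by rw [← h']; simp, hb'⟩
            · rw [h, Set.pair_comm]
      rw [hTeq] at hrcxy hT3 hTQ
      have hpQ : p ∈ Q := by rcases hp_ab with rfl | rfl; exact haQ; exact hbQ
      have hp'Q : p' ∈ Q := by rcases hp'_ab with rfl | rfl; exact haQ; exact hbQ
      have hpc : p ≠ c := by rcases hp_ab with rfl | rfl; exact hca.symm; exact hcb.symm
      have hp'c : p' ≠ c := by rcases hp'_ab with rfl | rfl; exact hca.symm; exact hcb.symm
      have hp'q : p' ≠ q := by rcases hp'_ab with rfl | rfl; exact hqa.symm; exact hqb.symm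
      -- `K1 := {{c, p, q}}`, disjoint from `Kab` (it misses `p'`)
      set K1 : Set (Set α) := { {c, p, q} } with hK1
      have hK1sub : K1 ⊆ {S : Set α | S ⊆ Q ∧ S.ncard = 3} := by
        intro S hS; rw [mem_singleton_iff] at hS; rw [hS]; exact ⟨hTQ, hT3⟩
      have hK1kill : ∀ C, M.IsCircuit C → C.ncard = 4 → e ∈ C → C ⊆ P → C \ {e} ∉ K1 := by
        intro C hC hC4 _ _ hmem
        rw [mem_singleton_iff] at hmem
        exact not_fourCircuit_of_triple_subset M hC hC4 (T := {c, p, q}) (by rw [← hmem]; exact sdiff_subset)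
          hT3 hrcxy
      have hp'notT : p' ∉ ({c, p, q} : Set α) := by
        simp only [mem_insert_iff, mem_singleton_iff, not_or]; exact ⟨hp'c, hpp'.symm, hp'q⟩
      have hdisj1 : Disjoint Kab K1 := by
        rw [disjoint_left]
        intro S h1 h2
        rw [mem_singleton_iff] at h2
        rw [h2] at h1
        rcases hp'_ab with rfl | rfl
        · exact hp'notT h1.2.2.1
        · exact hp'notT h1.2.2.2
      -- the fifth point `w` of `Q`
      have hsub4 : ({a, b, c, q} : Set α) ⊆ Q := by
        intro t ht; simp only [mem_insert_iff, mem_singleton_iff] at ht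
        rcases ht with rfl | rfl | rfl | rfl; exact haQ; exact hbQ; exact hcQ; exact hqQ
      have h4 : ({a, b, c, q} : Set α).ncard = 4 := by
        rw [ncard_insert_of_notMem (by simp [hab, hca.symm, hqa.symm]) (toFinite _),
          ncard_eq_three.2 ⟨b, c, q, hcb.symm, hqb.symm, hqc.symm, rfl⟩]
      have hw1 : (Q \ {a, b, c, q}).ncard = 1 := by
        have := ncard_sdiff_add_ncard_of_subset hsub4 hQfin; omega
      obtain ⟨w, hw⟩ := ncard_eq_one.1 hw1
      have hwQ : w ∈ Q \ {a, b, c, q} := by rw [hw]; simp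
      have hwa : w ≠ a := fun h => hwQ.2 (by rw [h]; simp)
      have hwb : w ≠ b := fun h => hwQ.2 (by rw [h]; simp)
      have hwc : w ≠ c := fun h => hwQ.2 (by rw [h]; simp)
      have hwq : w ≠ q := fun h => hwQ.2 (by rw [h]; simp)
      have hwp : w ≠ p := by rcases hp_ab with rfl | rfl; exact hwa; exact hwb
      obtain ⟨s, hsP, t, htP, hst, hsw, htw, hrwst⟩ := exists_triple_through_of_ncard_six M hfree hP hrP h6 hwQ.1.1
      by_cases hew : e = s ∨ e = t
      · -- 2b-i: a second rank-2 triple through `e`: `{e, w, v}`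
        obtain ⟨v, hvP, hvw, hve, hrwv⟩ : ∃ v ∈ P, v ≠ w ∧ v ≠ e ∧ M.eRk {e, w, v} ≤ 2 := by
          rcases hew with h | h
          · refine ⟨t, htP, htw, fun h' => hst (h'.trans h).symm, ?_⟩
            have : ({e, w, t} : Set α) = {w, s, t} := by rw [h, Set.insert_comm]
            rw [this]; exact hrwst
          · refine ⟨s, hsP, hsw, fun h' => hst (h'.trans h), ?_⟩
            have : ({e, w, s} : Set α) = {w, s, t} := by rw [h, Set.insert_comm, Set.pair_comm]
            rw [this]; exact hrwst
        exact hsecond w v hwQ.1 ⟨hvP, hve⟩ hvw.symm hrwv (by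
          intro h
          have : w ∈ ({e, a, b} : Set α) := h ▸ (by simp)
          simp only [mem_insert_iff, mem_singleton_iff] at this
          rcases this with h' | h' | h'
          · exact hwQ.1.2 h'
          · exact hwa h'
          · exact hwb h')
      · -- 2b-ii: `{w, s, t} ⊆ Q` is a new kill
        push Not at hew
        have hse : s ≠ e := fun h => hew.1 h.symm
        have hte : t ≠ e := fun h => hew.2 h.symm
        have hW3 : ({w, s, t} : Set α).ncard = 3 := ncard_eq_three.2 ⟨w, s, t, hsw.symm, htw.symm, hst, rfl⟩
        have hWQ : ({w, s, t} : Set α) ⊆ Q := by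
          intro u hu; simp only [mem_insert_iff, mem_singleton_iff] at hu
          rcases hu with rfl | rfl | rfl; exact hwQ.1; exact ⟨hsP, hse⟩; exact ⟨htP, hte⟩
        set K2 : Set (Set α) := { {w, s, t} } with hK2
        have hK2sub : K2 ⊆ {S : Set α | S ⊆ Q ∧ S.ncard = 3} := by
          intro S hS; rw [mem_singleton_iff] at hS; rw [hS]; exact ⟨hWQ, hW3⟩
        have hK2kill : ∀ C, M.IsCircuit C → C.ncard = 4 → e ∈ C → C ⊆ P → C \ {e} ∉ K2 := by
          intro C hC hC4 _ _ hmem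
          rw [mem_singleton_iff] at hmem
          exact not_fourCircuit_of_triple_subset M hC hC4 (T := {w, s, t}) (by rw [← hmem]; exact sdiff_subset)
            hW3 hrwst
        -- `{w, s, t} ∉ Kab`: else `{w, a, b}` and `{e, a, b}` are rank-2 triples sharing `a, b`, so `w = e`
        have hdisj2 : Disjoint Kab K2 := by
          rw [disjoint_left]
          intro S h1 h2
          rw [mem_singleton_iff] at h2
          rw [h2] at h1
          have hWE : ({w, s, t} : Set α) ⊆ M.E := hWQ.trans (hQP.trans hP)
          have hne' : ({e, a, b} : Set α) ≠ {w, s, t} := by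
            intro h
            have : e ∈ ({w, s, t} : Set α) := h ▸ (by simp)
            exact (hWQ this).2 rfl
          have hint := inter_ncard_le_one_of_triples M hfree hEab hWE hrab hrwst h3ab hW3 hne'
          have : ({a, b} : Set α) ⊆ {e, a, b} ∩ {w, s, t} := by
            intro u hu; simp only [mem_insert_iff, mem_singleton_iff] at hu
            rcases hu with rfl | rfl
            · exact ⟨by simp, h1.2.2.1⟩
            · exact ⟨by simp, h1.2.2.2⟩
          have := ncard_le_ncard this ((toFinite _).inter_of_left _)
          rw [ncard_pair hab] at this; omega
        have hdisj3 : Disjoint K1 K2 := by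
          rw [disjoint_left]
          intro S h1 h2
          rw [mem_singleton_iff] at h1 h2
          rw [h1] at h2
          have : w ∈ ({c, p, q} : Set α) := h2 ▸ (by simp)
          simp only [mem_insert_iff, mem_singleton_iff] at this
          rcases this with h' | h' | h'
          · exact hwc h'
          · exact hwp h'
          · exact hwq h'
        refine ⟨Kab ∪ (K1 ∪ K2), union_subset hKabsub (union_subset hK1sub hK2sub), ?_, ?_⟩
        · have hfinK : ∀ K : Set (Set α), K ⊆ {S : Set α | S ⊆ Q ∧ S.ncard = 3} → K.Finite :=
            fun K hK => hQfin.finite_subsets.subset (fun S hS => (hK hS).1)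
          have h12 : (K1 ∪ K2).ncard = 2 := by
            rw [ncard_union_eq hdisj3 (hfinK K1 hK1sub) (hfinK K2 hK2sub), hK1, hK2, ncard_singleton, ncard_singleton]
          have hd : Disjoint Kab (K1 ∪ K2) := disjoint_union_right.2 ⟨hdisj1, hdisj2⟩
          rw [ncard_union_eq hd (hfinK Kab hKabsub) (hfinK _ (union_subset hK1sub hK2sub)), hKab3, h12]
        · intro C hC hC4 heC hCP hmem
          rcases hmem with h | h | h
          · exact hKabkill C hC hC4 heC hCP h
          · exact hK1kill C hC hC4 heC hCP h
          · exact hK2kill C hC hC4 heC hCP h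
    · -- Sub-case 2a: `{c, x, y}` and `{e, a, b}` are two DISJOINT rank-2 triples covering `P`: impossible
      push Not at hmeet
      exact (not_two_disjoint_triples_in_six_plane M hfree hP hrP h6 he haP hbP hcQ.1 hxP hyP hae hbe hab hca hcb hce
        hxe hye hxc hyc hxy hrab hrcxy hmeet).elim
end S1

end PercRepro
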